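import Summits.ResolutionOfSingularities.ResolutionOfSingularities.Theorems.PurelyInseparableDim4IsolatedMultiplicity
import Summits.ResolutionOfSingularities.ResolutionOfSingularities.Theorems.PurelyInseparableDim4ShapeLemma3
import HarnessLib

/-!
# [OURS · res-dim4-pi F4-I Lemma (B⁺)] Isolated `q`-fold points: PAIRS and TRIPLES of exceptional components
  carry small total multiplicity

Cell `res-dim4-pi` (D-0157 DOOR 2), frame v4 TIER 1 (I); seat `res-dim4-p-5`. Def-free sequel of
`PurelyInseparableDim4IsolatedBand` (IB-1, p649049) and `…IsolatedMultiplicity` (Lemma (B), p650496), same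
technique one codimension up: the layer argument along TWO (resp. THREE) variables and Krull's height bound
for THREE generators (`ht ≤ 3 < 4 = ht 𝔪₀`; the three-generator lemma itself is p-9's
`FreeTail.not_isIsolated_of_le_span_triple` of `…ShapeLemma3` (SH3, card I-7-2), whose q = 3, a = c = 1 case
`not_isIsolated_three_of_two_layers` this file generalises to every `q` and every pair/triple of layers).

## What is proved (every field, every `q ≥ 2`; `j, k, l` pairwise distinct)
* §1 **`not_isIsolated_of_le_span_finset`** (any finset `T ⊆ 𝔪₀` with `#T ≤ 3` and `J_q⁺(G) ≤ (T)` ⇒ not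
  isolated) — the `≤ 3`-generator Krull lemma (finset form of SH3's triple lemma / IB-1's pair lemma).
* §2 `hasseDeriv_mem_or_eq_of_bilayer` — if every monomial of `F` has `x_j`-exponent `≥ a` and `x_k`-exponent
  `≥ c`, a Hasse derivative of order `≤ a + c` lies in `(x_j)` or in `(x_k)` unless it is `D^{(a e_j + c e_k)}`.
* §3 **`not_isIsolated_of_bilayer`**: `F ∈ (x_j^a x_k^c)` with `q − 1 ≤ a + c` ⇒ not isolated;
  **`not_isIsolated_of_trilayer`**: `F ∈ (x_j^a x_k^c x_l^d)` with `q ≤ a + c + d` ⇒ not isolated.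
* §4 Frame corollaries (state `s`, walk invariant `x^r ∣ F`): **`apply_add_apply_le_of_isIsolated`**
  (`r_j + r_k ≤ q − 2`), **`apply_add_add_le_of_isIsolated`** (`r_j + r_k + r_l ≤ q − 1`), and at `q = 3`:
  `not_two_components_of_isIsolated_three` (an isolated triple point lies on AT MOST ONE exceptional component
  dividing `F`) — the boundary bookkeeping of isolated chains at `p = 3` for the census (idea-7 K2, EN-9 at p = 3).

[OURS · counted 0 · AI work weaker than expert review] Nothing here proves `NoIsolatedTrap` or resolution of
singularities in dimension ≥ 4 / characteristic `p`; bookkeeping about OUR candidate frame.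
bears_on: LADDER-RESOLUTION:D157-DOOR2 (res-dim4-pi · F4-I Lemma (B⁺)). Supports stmt-ResolutionOfSingularities-16155
(helper).
-/

set_option linter.dupNamespace false -- mandated namespace of this single-conjunct summit

noncomputable section

namespace Summit.ResolutionOfSingularities.ResolutionOfSingularities.Theorems.PIDim4

namespace IsolatedBand

open MvPolynomial Finset
open Literature.AlgebraicGeometry.Resolution
open Literature.AlgebraicGeometry.Resolution.CentreBlowup

variable {K : Type} [Field K]

/-! ## §1 Up to three generators in `𝔪₀` never isolate the origin -/

/-- **Krull for `≤ 3` generators.** If `J_q⁺(G) ≤ (T)` for a finite set `T ⊆ 𝔪₀` of at most three polynomials,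
then the origin is not an isolated `q`-fold point: a minimal prime of `(T)` below `𝔪₀` has height `≤ 3 < 4 = ht 𝔪₀`,
so `J_q⁺(G)` has a minimal prime strictly inside `𝔪₀`. [folklore] -/
theorem not_isIsolated_of_le_span_finset {q : ℕ} {G : MvPolynomial (Fin 4) K}
    {T : Finset (MvPolynomial (Fin 4) K)} (hT : ∀ f ∈ T, f ∈ originIdeal K) (hcard : T.card ≤ 3)
    (hJ : singLocusIdeal q G ≤ Ideal.span (T : Set (MvPolynomial (Fin 4) K))) : ¬ IsIsolated q G := by
  classical
  haveI := originIdeal_isPrime (K := K)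
  have hI : Ideal.span (T : Set (MvPolynomial (Fin 4) K)) ≤ originIdeal K := by
    rw [Ideal.span_le]
    exact fun f hf => hT f (Finset.mem_coe.mp hf)
  obtain ⟨P₁, hP₁, hP₁le⟩ := Ideal.exists_minimalPrimes_le hI
  haveI hP₁prime : P₁.IsPrime := hP₁.1.1
  have hht : P₁.height ≤ 3 :=
    le_trans (Ideal.height_le_card_of_mem_minimalPrimes_span_finset hP₁) (by exact_mod_cast hcard)
  have hne : P₁ ≠ originIdeal K := by
    intro h
    rw [h] at hht
    have h4 := four_le_height_originIdeal (K := K)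
    have : (4 : ℕ∞) ≤ 3 := le_trans h4 hht
    exact absurd this (by decide)
  rintro ⟨-, hall⟩
  obtain ⟨P, hP, hPle⟩ := Ideal.exists_minimalPrimes_le (hJ.trans hP₁.1.2)
  have hP𝔪 : P = originIdeal K := hall P hP (hPle.trans hP₁le)
  exact hne (le_antisymm hP₁le (hP𝔪 ▸ hPle))

/-! ## §2 The two-variable layer dichotomy -/

/-- An exponent `α` with `α_j ≥ a`, `α_k ≥ c` and `|α| ≤ a + c` (`j ≠ k`) is exactly `a·e_j + c·e_k`. [folklore] -/
theorem eq_single_add_single_of_le {j k : Fin 4} (hjk : j ≠ k) {a c : ℕ} {α : Fin 4 →₀ ℕ}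
    (hj : a ≤ α j) (hk : c ≤ α k) (hdeg : α.degree ≤ a + c) :
    α = Finsupp.single j a + Finsupp.single k c := by
  classical
  have hsum : α.degree = α j + α k + ∑ i ∈ (Finset.univ.erase j).erase k, α i := by
    rw [Finsupp.degree_eq_sum, ← Finset.add_sum_erase _ _ (Finset.mem_univ j),
      ← Finset.add_sum_erase _ _ (Finset.mem_erase.mpr ⟨hjk.symm, Finset.mem_univ k⟩), add_assoc]
  have hrest : ∑ i ∈ (Finset.univ.erase j).erase k, α i = 0 := by omega
  have hja : α j = a := by omega
  have hkc : α k = c := by omega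
  ext i
  rw [Finsupp.add_apply]
  by_cases hij : i = j
  · subst hij
    rw [Finsupp.single_eq_same, Finsupp.single_eq_of_ne hjk, add_zero, hja]
  · by_cases hik : i = k
    · subst hik
      rw [Finsupp.single_eq_of_ne hij, Finsupp.single_eq_same, zero_add, hkc]
    · rw [Finsupp.single_eq_of_ne hij, Finsupp.single_eq_of_ne hik, add_zero]
      exact Finset.sum_eq_zero_iff.mp hrest i
        (Finset.mem_erase.mpr ⟨hik, Finset.mem_erase.mpr ⟨hij, Finset.mem_univ i⟩⟩)

/-- **Bilayer dichotomy.** If every monomial of `F` has `x_j`-exponent `≥ a` and `x_k`-exponent `≥ c` (`j ≠ k`),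
then a Hasse derivative `D^{(α)}F` with `|α| ≤ a + c` lies in `(x_j)`, or in `(x_k)`, or `α = a·e_j + c·e_k`.
[folklore] -/
theorem hasseDeriv_mem_or_eq_of_bilayer {j k : Fin 4} (hjk : j ≠ k) {a c : ℕ} {F : MvPolynomial (Fin 4) K}
    (hF : ∀ e ∈ F.support, a ≤ e j ∧ c ≤ e k) {α : Fin 4 →₀ ℕ} (hdeg : α.degree ≤ a + c) :
    hasseDeriv α F ∈ Ideal.span {(X j : MvPolynomial (Fin 4) K)} ∨
      hasseDeriv α F ∈ Ideal.span {(X k : MvPolynomial (Fin 4) K)} ∨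
        α = Finsupp.single j a + Finsupp.single k c := by
  by_cases hj : α j < a
  · exact Or.inl (hasseDeriv_mem_span_X_of_layer (fun e he => (hF e he).1) hj)
  · by_cases hk : α k < c
    · exact Or.inr (Or.inl (hasseDeriv_mem_span_X_of_layer (fun e he => (hF e he).2) hk))
    · push Not at hj hk
      exact Or.inr (Or.inr (eq_single_add_single_of_le hjk hj hk hdeg))

/-! ## §3 Bilayers and trilayers are never isolated -/

/-- `F ∈ (x_j^a x_k^c)` with `q ≤ a + c`: `J_q⁺(F) ≤ (x_j, x_k)`. [folklore] -/
theorem singLocusIdeal_le_span_X_pair_of_bilayer {q : ℕ} {j k : Fin 4} (hjk : j ≠ k) {a c : ℕ}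
    {F : MvPolynomial (Fin 4) K} (hF : ∀ e ∈ F.support, a ≤ e j ∧ c ≤ e k) (hq : q ≤ a + c) :
    singLocusIdeal q F ≤ Ideal.span {(X j : MvPolynomial (Fin 4) K), X k} := by
  unfold singLocusIdeal
  rw [Ideal.span_le]
  rintro _ ⟨α, -, hαq, rfl⟩
  rcases hasseDeriv_mem_or_eq_of_bilayer hjk hF (α := α) (by omega) with h | h | h
  · exact Ideal.span_mono (Set.singleton_subset_iff.mpr (Set.mem_insert _ _)) h
  · exact Ideal.span_mono (Set.singleton_subset_iff.mpr (Set.mem_insert_of_mem _ (Set.mem_singleton _))) h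
  · exfalso
    have : α.degree = a + c := by
      rw [h, map_add, Finsupp.degree_single, Finsupp.degree_single]
    omega

/-- `F ∈ (x_j^a x_k^c)` with `a + c < q`: `J_q⁺(F) ≤ (x_j, x_k, D^{(a e_j + c e_k)} F)`. [folklore] -/
theorem singLocusIdeal_le_span_triple_of_bilayer {q : ℕ} {j k : Fin 4} (hjk : j ≠ k) {a c : ℕ}
    {F : MvPolynomial (Fin 4) K} (hF : ∀ e ∈ F.support, a ≤ e j ∧ c ≤ e k) (hq : q ≤ a + c + 1) :
    singLocusIdeal q F ≤ Ideal.span {(X j : MvPolynomial (Fin 4) K), X k,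
      hasseDeriv (Finsupp.single j a + Finsupp.single k c) F} := by
  unfold singLocusIdeal
  rw [Ideal.span_le]
  rintro _ ⟨α, -, hαq, rfl⟩
  rcases hasseDeriv_mem_or_eq_of_bilayer hjk hF (α := α) (by omega) with h | h | h
  · exact Ideal.span_mono (Set.singleton_subset_iff.mpr (Set.mem_insert _ _)) h
  · exact Ideal.span_mono (Set.singleton_subset_iff.mpr
      (Set.mem_insert_of_mem _ (Set.mem_insert _ _))) h
  · subst h
    exact Ideal.subset_span (Set.mem_insert_of_mem _ (Set.mem_insert_of_mem _ (Set.mem_singleton _)))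

/-- **BILAYERS ARE NOT ISOLATED.** If every monomial of `F` has `x_j`-exponent `≥ a` and `x_k`-exponent
`≥ c` (`j ≠ k`) with `q − 1 ≤ a + c` (`q ≥ 2`), the origin is NOT an isolated `q`-fold point: the plane
`x_j = x_k = 0` meets the `q`-fold locus in (at least) the curve cut out by `D^{(a e_j + c e_k)}F`.
[folklore] -/
theorem not_isIsolated_of_bilayer {q : ℕ} (hq2 : 2 ≤ q) {j k : Fin 4} (hjk : j ≠ k) {a c : ℕ}
    {F : MvPolynomial (Fin 4) K} (hF : ∀ e ∈ F.support, a ≤ e j ∧ c ≤ e k) (hq : q ≤ a + c + 1) :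
    ¬ IsIsolated q F := by
  by_cases hle : q ≤ a + c
  · exact not_isIsolated_of_le_span_pair (singLocusIdeal_le_span_X_pair_of_bilayer hjk hF hle)
      (IsolatedScope.X_mem_originIdeal j) (IsolatedScope.X_mem_originIdeal k)
  · have hJ := singLocusIdeal_le_span_triple_of_bilayer hjk hF hq
    by_cases hD : hasseDeriv (Finsupp.single j a + Finsupp.single k c) F ∈ originIdeal K
    · exact FreeTail.not_isIsolated_of_le_span_triple hJ (IsolatedScope.X_mem_originIdeal j)
        (IsolatedScope.X_mem_originIdeal k) hD
    · -- the third generator is itself in `J_q⁺(F)` (`0 < a + c = q − 1 < q`), so `J_q⁺(F) ≰ 𝔪₀`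
      rintro ⟨hle0, -⟩
      apply hD
      refine hle0 (Ideal.subset_span ⟨Finsupp.single j a + Finsupp.single k c, ?_, ?_, rfl⟩)
      · rw [map_add, Finsupp.degree_single, Finsupp.degree_single]; omega
      · rw [map_add, Finsupp.degree_single, Finsupp.degree_single]; omega

/-- **TRILAYERS ARE NOT ISOLATED.** If every monomial of `F` has `x_j`-, `x_k`-, `x_l`-exponents `≥ a, c, d`
(pairwise distinct indices) with `q ≤ a + c + d`, then `J_q⁺(F) ≤ (x_j, x_k, x_l)` and the origin is not
isolated (the coordinate LINE lies in the `q`-fold locus). [folklore] -/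
theorem not_isIsolated_of_trilayer {q : ℕ} {j k l : Fin 4} (hjk : j ≠ k) (hjl : j ≠ l) (hkl : k ≠ l)
    {a c d : ℕ} {F : MvPolynomial (Fin 4) K} (hF : ∀ e ∈ F.support, a ≤ e j ∧ c ≤ e k ∧ d ≤ e l)
    (hq : q ≤ a + c + d) : ¬ IsIsolated q F := by
  classical
  refine FreeTail.not_isIsolated_of_le_span_triple (f := X j) (g := X k) (h := X l) ?_
    (IsolatedScope.X_mem_originIdeal j) (IsolatedScope.X_mem_originIdeal k) (IsolatedScope.X_mem_originIdeal l)
  unfold singLocusIdeal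
  rw [Ideal.span_le]
  rintro _ ⟨α, -, hαq, rfl⟩
  by_cases hj : α j < a
  · exact Ideal.span_mono (Set.singleton_subset_iff.mpr (Set.mem_insert _ _))
      (hasseDeriv_mem_span_X_of_layer (fun e he => (hF e he).1) hj)
  by_cases hk : α k < c
  · exact Ideal.span_mono (Set.singleton_subset_iff.mpr (Set.mem_insert_of_mem _ (Set.mem_insert _ _)))
      (hasseDeriv_mem_span_X_of_layer (fun e he => (hF e he).2.1) hk)
  by_cases hl : α l < d
  · exact Ideal.span_mono (Set.singleton_subset_iff.mpr
      (Set.mem_insert_of_mem _ (Set.mem_insert_of_mem _ (Set.mem_singleton _))))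
      (hasseDeriv_mem_span_X_of_layer (fun e he => (hF e he).2.2) hl)
  exfalso
  push Not at hj hk hl
  have hsum : α j + α k + α l ≤ α.degree := by
    have h3 : ∑ i ∈ ({j, k, l} : Finset (Fin 4)), α i = α j + α k + α l := by
      rw [Finset.sum_insert (by simp [hjk, hjl]), Finset.sum_insert (by simp [hkl]),
        Finset.sum_singleton, add_assoc]
    rw [Finsupp.degree_eq_sum, ← h3]
    exact Finset.sum_le_sum_of_subset (Finset.subset_univ _)
  omega

/-! ## §4 Frame corollaries: the exceptional monomial at an isolated point -/

/-- **Lemma (B⁺), pairs.** At an isolated `q`-fold point (`q ≥ 2`) with `x^r ∣ F`: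
`r_j + r_k ≤ q − 2` for every `j ≠ k`. [folklore] -/
theorem apply_add_apply_le_of_isIsolated {q : ℕ} (hq : 2 ≤ q) {s : State K} (hiso : IsIsolated q s.F)
    (hr : ∀ d ∈ s.F.support, s.r ≤ d) {j k : Fin 4} (hjk : j ≠ k) : s.r j + s.r k ≤ q - 2 := by
  by_contra hcon
  push Not at hcon
  refine not_isIsolated_of_bilayer hq hjk (a := s.r j) (c := s.r k)
    (fun e he => ⟨Finsupp.le_def.mp (hr e he) j, Finsupp.le_def.mp (hr e he) k⟩) (by omega) hiso

/-- **Lemma (B⁺), triples.** At an isolated `q`-fold point with `x^r ∣ F`: `r_j + r_k + r_l ≤ q − 1` for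
pairwise distinct `j, k, l`. [folklore] -/
theorem apply_add_add_le_of_isIsolated {q : ℕ} {s : State K} (hiso : IsIsolated q s.F)
    (hr : ∀ d ∈ s.F.support, s.r ≤ d) {j k l : Fin 4} (hjk : j ≠ k) (hjl : j ≠ l) (hkl : k ≠ l) :
    s.r j + s.r k + s.r l ≤ q - 1 := by
  by_contra hcon
  push Not at hcon
  refine not_isIsolated_of_trilayer hjk hjl hkl (a := s.r j) (c := s.r k) (d := s.r l)
    (fun e he => ⟨Finsupp.le_def.mp (hr e he) j, Finsupp.le_def.mp (hr e he) k,
      Finsupp.le_def.mp (hr e he) l⟩) (by omega) hiso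

/-- **`q = 3`: an isolated triple point lies on at most ONE exceptional component dividing `F`**
(`r_j + r_k ≤ 1`). [folklore] -/
theorem not_two_components_of_isIsolated_three {s : State K} (hiso : IsIsolated 3 s.F)
    (hr : ∀ d ∈ s.F.support, s.r ≤ d) {j k : Fin 4} (hjk : j ≠ k) : ¬ (1 ≤ s.r j ∧ 1 ≤ s.r k) := by
  have := apply_add_apply_le_of_isIsolated (by norm_num) hiso hr hjk
  omega

end IsolatedBand

end Summit.ResolutionOfSingularities.ResolutionOfSingularities.Theorems.PIDim4

end
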